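import Mathlib
import HarnessLib
import Summits.ResolutionOfSingularities.ResolutionOfSingularities.Theorems.WildQuotientsWildQuotientResolutionConductorOneScaffold
import Summits.ResolutionOfSingularities.ResolutionOfSingularities.Theorems.WildQuotientsWildQuotientResolutionConductorOneFrame

/-!
# S2 — THE CONDUCTOR-𝟙 CORE IS RESOLVED: `HasResolution (Spec Aₙ^σ)` for every prime `p` and every `n ≥ 1`

(crux stmt-ResolutionOfSingularities-15640 `WildQuotients.WildQuotientResolution`, line `Sketch`; S1 =
stmt-ResolutionOfSingularities-17941 `CyclicQuotientFourfolds`; chain w45c post-V5 programme S2 «diagonal products /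
conductor-𝟙 core» (`L/w45c/CHAIN.md` §4–§5; card L of res-L1-w45c-idea-2; design `L/res-L1-w45c-lead-1/S2-DESIGN.md`);
res-L1-w45c-plan-1 ASSIGN 2026-08-27T21:22:26Z / 21:27:20Z («F9 IS YOURS»). [OURS · L1 W4.5c] — NOT a statement of
any manuscript; replaces the role of no printed item; AI-produced, weaker than expert review; counted 0 (a SPECIMEN
family for the wild-quotient programme, not a route target). Def-free. Prover res-D-pv-033; scaffold res-L1-w45c-lead-1.)

`Aₙ = k[u₁,…,uₙ][Dₙ⁻¹]` (`CoreRing k p n`), `σ` the `k`-automorphism with `σ(uᵢ)·(1+uᵢ) = uᵢ` (order `p`), the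
diagonal `ℤ/p`-quotient of a product of `n` germs of `z ↦ z + 1` at `z = ∞` (conductor `𝟙`). The quotient
`Spec Aₙ^⟨σ⟩` has a resolution of singularities: lead-1's scaffold `conductorOneCore_hasResolution_of_frame` (F8: the
frame HF ⇒ resolution, via the presentation brick F5, the toric fan F6 of res-L1-w45c-stub-4, the isolated local
blow-ups F7 of res-L1-w45c-stub-3, and G2) fed with the frame `frameBrick` (F3, res-D-pv-033: `Bl_𝔪 Spec Aₙ` with
the lifted action, the `2ⁿ − 1` stable affine pieces `O_I`, the seams `Γ(O_I) ≃ k[s,c,e][h_M⁻¹]` with the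
diagonal-Möbius action, and the boolean-point separation).
-/

-- single-problem summit: the doubled namespace component `ResolutionOfSingularities` is forced
set_option linter.dupNamespace false

noncomputable section

open CategoryTheory AlgebraicGeometry

namespace Summit.ResolutionOfSingularities.ResolutionOfSingularities.Theorems.WildQuotientResolution.ConductorOne

/-- **THE CONDUCTOR-𝟙 CORE QUOTIENT IS RESOLVABLE**: for every prime `p`, every field `k` of characteristic `p`,
every `n ≥ 1` and every `σ` with the conductor-𝟙 law, `Spec (Aₙ^⟨σ⟩)` has a resolution of singularities.
[OURS · L1 W4.5c] -/
theorem conductorOneCore_hasResolution (p : ℕ) (hp : p.Prime) (k : Type) [Field k] [CharP k p]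
    (n : ℕ) (hn : 1 ≤ n) (σ : CoreRing k p n ≃ₐ[k] CoreRing k p n)
    (hσ : ∀ i, σ (coreU k p n i) * (1 + coreU k p n i) = coreU k p n i) :
    Literature.AlgebraicGeometry.Resolution.Scheme.HasResolution (Spec (CommRingCat.of
      (FixedPoints.subalgebra k (CoreRing k p n) ↥(Subgroup.zpowers σ)))) :=
  haveI : Fact p.Prime := ⟨hp⟩
  conductorOneCore_hasResolution_of_frame p hp k n hn σ hσ (frameBrick k p n σ hn hσ)

end Summit.ResolutionOfSingularities.ResolutionOfSingularities.Theorems.WildQuotientResolution.ConductorOne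

end
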